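import Literature.Barriers.CriticalPhenomena.WeaklySAWFourDimLogCorrections
import HarnessLib.Audit

/-!
# BBS 2015, §1.3: the Cesàro-averaged asymptotics of `c_T` — the sign of `ν_c`

Companion to `WeaklySAWFourDimLogCorrections.lean` (namespace
`Literature.Barriers.CriticalPhenomena.CTWSAW`), same source: R. Bauerschmidt, D. C. Brydges,
G. Slade, *Logarithmic correction for the susceptibility of the 4-dimensional weakly self-avoiding
walk: a renormalisation group analysis*, CMP 337 (2015), arXiv:1403.7422.

## What the source prints and what it defines

§1.1, (1.3): `χ(g,ν) = ∫₀^∞ c_{g,T} e^{-νT} dT`, `c_T = E(e^{-gI(T)})`; "there exists a critical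
value `ν_c = ν_c(d,g) ∈ (-∞,0]` such that `χ(g,ν) < ∞` if and only if `ν > ν_c`" (Lemma A.1).
§1.3, first paragraph: "(1.11) shows that `ν_c(g) < 0` for `g > 0`" (small `g`, Theorem 1.2).
§1.3, the two displays after "For `d = 4`, Theorem 1.1 and a standard Tauberian theorem [Fell71]
imply that": `T⁻¹∫₀ᵀ c_S e^{ν_c S} dS ∼ A_g (log T)^{1/4}` ((1.13) of the arXiv version; proved) and "It is believed that
[this] remains true without Cesàro average in `T`, i.e., that `c_T ∼ A_g e^{-ν_c T}(log T)^{1/4}`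
… but our present estimates do not suffice to prove [it]" ((1.14) of the arXiv version; equation
numbers of §1.3 are counted from the arXiv source, and the locators below are by content).

## The discrepancy

By (1.3), `χ(g, ν_c + ε) = ∫₀^∞ (c_T e^{-ν_c T}) e^{-εT} dT`; Theorem 1.1 says this is
`∼ A_g ε⁻¹ (log ε⁻¹)^{1/4}` as `ε ↓ 0`, and Karamata's Tauberian theorem (index `1`, slowly
varying factor `(log ·)^{1/4}`; Feller vol. II, XIII.5) turns that into
`∫₀ᵀ c_S e^{-ν_c S} dS ∼ A_g T (log T)^{1/4}`. So the display the paper derives carries `e^{-ν_c S}`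
and the believed pointwise form is `c_T ∼ A_g e^{+ν_c T}(log T)^{1/4}`: both printed displays have
the sign of `ν_c` flipped relative to the paper's own (1.3). In print this is a harmless slip
(`ν_c < 0` is recalled a few lines earlier); transcribed literally it is fatal: `c_S ≤ 1` and
`ν_c < 0` give `T⁻¹∫₀ᵀ c_S e^{ν_c S} dS ≤ (|ν_c| T)⁻¹ → 0`, whereas `A_g (log T)^{1/4} → ∞`.
The literal transcriptions `CTWSAW.BBS2015_cesaro` and `CTWSAW.BBS2015_pointwise_prediction` of
`WeaklySAWFourDimLogCorrections.lean` are therefore not the statements the paper proves resp.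
conjectures; they are kept there verbatim as the literal record, refuted
(`WeaklySAWFourDimLogCorrectionsDecay.lean`) and `@[deprecated]` (2026-08-15, mis-stated), and the
corrected readings are vendored HERE under new names, with the same locators:

* `CTWSAW.BBS2015_cesaro_corrected` — `T⁻¹∫₀ᵀ c_S e^{-ν_c S} dS ∼ A (log T)^{1/4}` for `d = 4`,
  small `g > 0`, some `A > 0` (in print `A = A_g` of Theorem 1.1);
* `CTWSAW.BBS2015_pointwise_prediction_corrected` — `c_T e^{-ν_c T} ∼ A (log T)^{1/4}` (believed,
  NOT proved): a registered OPEN CONJECTURE (`OPEN CONJECTURE —` docstring, `[status: open]`;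
  CONVENTIONS §4), not literature debt; the name is kept (a user in
  `WeaklySAWFourDimLogCorrectionsCesaroProofs.lean`, `BBS2015_cesaro_corrected_of_pointwise`).

Nothing is asserted in this file (named facts only). The derivation of
`BBS2015_cesaro_corrected` from `BBS2015_thm11` by the Tauberian theorem, and the refutation of the
literal `BBS2015_cesaro`, are the business of sibling `…Proofs` files.

Revision 2026-08-16 (verdict clean-up of `BBS2015_pointwise_prediction_corrected`): statements
unchanged; the open status was re-verified against the source (arXiv:1403.7422, §1.3: (1.14) is
introduced by "It is believed that" and followed by "but our present estimates do not suffice to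
prove (1.14)") and against the later literature, and the docstring locators were sharpened — the
displays of §1.3 are named by equation number ((1.12) `χ(0,m²) = m⁻²`, (1.13) Cesàro, (1.14)
pointwise), and the BBS 2019 passage on proved extensions / the hierarchical walk is Ch. 11, §11.1,
subsection "Continuous-time weakly self-avoiding walk" of LNM 2242 (subsection 11.1.3: the third
subsection of the chapter's first section "Critical behaviour of self-avoiding walk"; chapter-relative
"1.3" in the held text rendering of arXiv:1907.05474, whence the locator "§11.3" used previously).
-/

noncomputable section

open MeasureTheory Filter Topology
open scoped ENNReal

namespace Literature.Barriers.CriticalPhenomena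

namespace CTWSAW

/-- **Sign-corrected reading of `BBS2015_cesaro`** (Bauerschmidt–Brydges–Slade 2015, §1.3,
display (1.13) of the arXiv version — the second display of §1.3, the one introduced by "For
`d = 4`, Theorem 1.1 and a standard Tauberian theorem [Fell71] imply that":
`T⁻¹∫₀ᵀ c_S e^{ν_c S} dS ∼ A_g (log T)^{1/4}`). With the paper's definition
`χ(g,ν) = ∫₀^∞ c_T e^{-νT} dT` (§1.1, (1.3)) the Tauberian hypothesis supplied by Theorem 1.1 is
`χ(g, ν_c + ε) = ∫₀^∞ (c_T e^{-ν_c T}) e^{-εT} dT ∼ A_g ε⁻¹(log ε⁻¹)^{1/4}`, whose Tauberian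
conclusion is `∫₀ᵀ c_S e^{-ν_c S} dS ∼ A_g T (log T)^{1/4}`: the exponential carries `-ν_c`. (Read
with `+ν_c`, as printed and as transcribed in `BBS2015_cesaro`, the left side is `≤ (|ν_c| T)⁻¹ → 0`
because `c_S ≤ 1` and `ν_c < 0`, §1.3 first paragraph.) Apart from that sign this is
`BBS2015_cesaro` verbatim: `d = 4`, all sufficiently small `g > 0`, "some `A > 0`" (in print the
`A_g` of Theorem 1.1), `∼` meaning ratio `→ 1` as `T → ∞`.
[cite: BauerschmidtBrydgesSlade2015LogCorr, §1.3 (Cesàro average of c_T), sign of ν_c per §1.1 (1.3)] -/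
def BBS2015_cesaro_corrected : Prop :=
  ∃ g₀ : ℝ, 0 < g₀ ∧ ∀ g : ℝ, 0 < g → g < g₀ →
    ∃ A : ℝ, 0 < A ∧
      Tendsto (fun T : ℝ =>
          (∫⁻ S in Set.Ioc 0 T,
              survival 4 g S * ENNReal.ofReal (Real.exp (-criticalNu 4 g * S))).toReal /
            (T * (A * Real.log T ^ (1 / 4 : ℝ))))
        atTop (𝓝 1)

/-- OPEN CONJECTURE — **pointwise asymptotics of `c_T` for the 4-dimensional weakly self-avoiding
walk**: for `d = 4` and every sufficiently small `g > 0` there is `A > 0` (in print the `A_g` of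
Theorem 1.1) with `c_T e^{-ν_c T} / (A (log T)^{1/4}) → 1` as `T → ∞`, i.e.
`c_T ∼ A_g e^{ν_c T}(log T)^{1/4}`. POSED, as a belief and not as a theorem, in
Bauerschmidt–Brydges–Slade 2015, §1.3, display (1.14) of the arXiv version (the third display of
§1.3, immediately after the Cesàro display (1.13)): "It is believed that [(1.13)] remains true
without Cesàro average in `T`, i.e., that `c_T ∼ A_g e^{-ν_c T}(log T)^{1/4}` …, but our present
estimates do not suffice to prove [(1.14)]" — here with the sign of `ν_c` CORRECTED per the
paper's own (1.3) (`χ(g,ν) = ∫₀^∞ c_T e^{-νT} dT`, §1.1) and `ν_c < 0` (§1.3, first paragraph): since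
`c_T ≤ 1`, the display read literally is false (`not_BBS2015_pointwise_prediction`,
`WeaklySAWFourDimLogCorrectionsDecay.lean`, refuting the deprecated literal transcription
`BBS2015_pointwise_prediction` of `WeaklySAWFourDimLogCorrections.lean`), and the intended statement
— the one whose Cesàro average is `BBS2015_cesaro_corrected`, which the paper derives from
Theorem 1.1 (in tree: `BBS2015_cesaro_corrected_of_thm11`; the Cesàro implication from THIS statement
is `BBS2015_cesaro_corrected_of_pointwise`; both `WeaklySAWFourDimLogCorrectionsCesaroProofs.lean`)
— is this one. Still open: Bauerschmidt–Brydges–Slade 2019 (LNM 2242), Ch. 11, §11.1, subsection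
"Continuous-time weakly self-avoiding walk" (subsection 11.1.3, the one stating Theorem 1.1 of
BBS 2015 as its theorem; arXiv:1907.05474, chapter "Self-avoiding walk and supersymmetry", whose held
text rendering numbers it chapter-relatively as "1.3" — whence the locator "§11.3" of earlier
revisions of this docstring), lists what the renormalisation-group method has proved beyond
Theorem 1.1 — "the critical behaviour of the correlation length of order `p` in dimension 4 […], the
lack of effect of a small contact self-attraction in dimension 4 […], the construction of the
tricritical theta point for polymer collapse in dimension 3 […], and … non-Gaussian critical
exponents for a long-range model below the upper critical dimension […]" (Bauerschmidt–Slade–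
Tomberg–Wallace 2017; Bauerschmidt–Slade–Wallace 2017; Bauerschmidt–Lohmann–Slade 2020; Slade 2018,
Lohmann–Slade–Wallace 2017) — without it, and records fixed-`T` asymptotics ("the predicted
behaviour `T^{1/2}|log T|^{1/8}` for the mean end-to-end distance") only for "a 4-dimensional
hierarchical version of the continuous-time weakly self-avoiding walk" (Brydges–Evans–Imbrie 1992;
Brydges–Imbrie 2003). Re-verified 2026-08-16 (this revision): (1.14) is posed, not proved, in the
source, and no proof for the walk on `ℤ⁴` was located in the later literature (zbMATH / arXiv,
2015–2026). Not a theorem in print; no `_holds` discharge is expected — a registered open statement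
(CONVENTIONS §4: open conjectures are `def … : Prop`), not literature debt; users take
`(h : BBS2015_pointwise_prediction_corrected)`. The name is kept (not renamed `…Conjecture`) because
`WeaklySAWFourDimLogCorrectionsCesaroProofs.lean` consumes it (`BBS2015_cesaro_corrected_of_pointwise`).
[cite: BauerschmidtBrydgesSlade2015LogCorr, §1.3 (1.14) (pointwise asymptotics of c_T, believed: where it is posed), sign of ν_c per §1.1 (1.3)]
[cite: BauerschmidtBrydgesSlade2019RG, Ch. 11 §11.1, subsection "Continuous-time weakly self-avoiding walk" (not among the proved extensions; fixed-T asymptotics only for the hierarchical walk)] [status: open] -/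
@[conjecture] def BBS2015_pointwise_prediction_corrected : Prop :=
  ∃ g₀ : ℝ, 0 < g₀ ∧ ∀ g : ℝ, 0 < g → g < g₀ →
    ∃ A : ℝ, 0 < A ∧
      Tendsto (fun T : ℝ =>
          (survival 4 g T).toReal * Real.exp (-criticalNu 4 g * T) /
            (A * Real.log T ^ (1 / 4 : ℝ)))
        atTop (𝓝 1)

end CTWSAW

end Literature.Barriers.CriticalPhenomena
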